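import Summits.BirchSwinnertonDyer.BirchSwinnertonDyer.Theorems.GenusKolyvaginAtTwoPowDvdShaCardAtTwoRTEigenNorms
import HarnessLib

/-!
# Route `GenusKolyvaginAtTwo`, crux L_T `PowDvdShaCardAtTwoRT` (stmt-BirchSwinnertonDyer-23242), LINE 18 stub KS, the DROPS —
# THE LOST-BIT LAW FOR AN INVARIANT PAIRING: same-sign eigenvectors of two free rank-one `ℤ/2^M[C₂]`-modules in a
# `τ`-INVARIANT perfect pairing lose exactly ONE bit; opposite signs are orthogonal

Seat `bsd-line-gk2-p3` g23 (PROVER seat 3/3, cell `bsd-f1-sign2`), `--supports stmt-BirchSwinnertonDyer-23242` (helper; closes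
nothing).  Mathlib-only algebra over LEAD gk2-p1 g15's `…RTEigenNorms` (normal forms of eigenvectors in a free rank-one
`ℤ/2^M[C₂]`-module).  THEOREMS ONLY (no definition, no named fact, no `sorry`).  BSD is NOT proved by any of this; neither is
the crux nor any stub.

WHY (input `hrec` of gk2-p2's `PlusDescent.weakSwapOracle_of_twoPrimeReciprocity` — Kolyvagin, Math. Ann. 291 (1991) Thm. 2.1,
the two-term local-divisibility identity of the prime swap `ℓ₀ ↦ ℓ′`; LEAD memo `Cruxes/PowDvdShaCardAtTwoRT/Lines/plus-descent-lead-g17.md`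
§5/§7).  The two surviving terms of the reciprocity law for the SAME-SIGN pair `(c_M(nℓ′), c_M(nℓ₀))` over the Heegner field `K`
are values of the local Tate pairing `⟨X, Y⟩_λ = inv_λ(X ∪ₑ Y)` at a deep inert Kolyvagin place `λ`, between the class
`X = loc_λ c` at an OWN prime (read modulo the Kummer condition `𝓛_λ`) and an UNRAMIFIED class `Y ∈ 𝓛_λ`.  That pairing
is `τ`-INVARIANT, `⟨τ_* X, τ_* Y⟩_λ = ⟨X, Y⟩_λ` (THE invariant maps commute with the Galois transport of completions: tree
`isConjCompatible_canonical`, `localTatePairingZMod_conjActPlace`), and both `H¹(K_λ, E[2^M])/𝓛_λ` and `𝓛_λ` are free of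
rank one over `ℤ/2^M[C₂]` (`E[2^M] = ℤP₀ ⊕ ℤc₀P₀` on `Δ < 0`, route item Q1, via Howard's evaluation isomorphisms).  LEAD's
`…RTLostBitLaw` / `…RTLostBitWeil` treat the ANTI-invariant case (the Weil pairing itself: `e(c₀S, c₀T) = e(S,T)⁻¹`, fixed ×
anti-fixed informative).  For an INVARIANT pairing the roles flip — THIS FILE:

* §1 `addOrderOf_zsmul_two_nsmul_eq` — the order bookkeeping: for `g` of order `2^M`, `r` of order `2^{N_y} ≤ 2^M` and
  `a • g` of order `2^{N_x}`, the element `a • (2 • r)` has order `2^(N_x + N_y − (M+1))` (truncated).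
* §2 for `P : A × B → R` bi-additive with `P(τa, σb) = P(a, b)` (`τ`, `σ` involutions), `A` free of rank one over
  `ℤ/2^M[τ]` on `a₀`, and `P` right-non-degenerate on `B` against `a₀, τa₀` (`hnd`):
  `pairing_tau_left_of_invariant` (`P(τa, b) = P(a, σb)`); `addOrderOf_pairing_basis_eq_of_eigen` (for a `σ`-eigenvector `b`,
  `P(a₀, b)` has the order of `b`); **`pairing_eq_zero_of_opposite_signs`** (`τa = a`, `σb = −b` or `τa = −a`, `σb = b`
  ⟹ `P(a, b) = 0`); **`invariantLostBit_addOrderOf_pairing_same_sign`** (`τa = εa`, `σb = εb`, orders `2^{N_a}`, `2^{N_b}`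
  ⟹ `addOrderOf (P a b) = 2^(N_a + N_b − (M+1))`); the threshold form `pow_smul_pairing_eq_zero_iff_of_same_sign`
  (`2^j • P a b = 0 ⟺ N_a + N_b ≤ M + 1 + j`).
So at `p = 2` over `K` the lost bit occurs at BOTH places `λ′`, `λ₀` of Kolyvagin's identity and cancels: `d′ + d″ = d₀ + d₀′`.

References: [Kolyvagin1991MathAnn] Thm. 2.1 (proof via [LNM 1479, Prop. 8]); [McCallumLMS1991] §2, §4 Prop. 4.4, §5 Lemma 5.3 and
proof of Prop. 5.2 (13); [MilneADT2006] I Cor. 2.3; [Howard2004HeegnerKolyvagin] Prop. 1.1.7, Lemma 1.5.3.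
-/

set_option autoImplicit false
-- `Summit.<P>.<Sub>` repeats `BirchSwinnertonDyer` by the tree's layout convention (D-0017)
set_option linter.dupNamespace false

namespace Summit.BirchSwinnertonDyer.BirchSwinnertonDyer.Theorems.GenusExact.PlusDescent

/-! ## §1 Orders: one bit shifted -/

section Orders

variable {G R : Type*} [AddCommGroup G] [AddCommGroup R]

/-- An element of order `2^N` is killed by `2^M` for `N ≤ M` (integer form). [folklore] -/
theorem two_pow_zsmul_eq_zero_of_addOrderOf_eq {r : R} {N M : ℕ} (hr : addOrderOf r = 2 ^ N) (hNM : N ≤ M) :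
    (2 ^ M : ℤ) • r = 0 := by
  have h : (2 ^ M : ℕ) • r = 0 := by
    rw [← addOrderOf_dvd_iff_nsmul_eq_zero, hr]
    exact pow_dvd_pow 2 hNM
  exact_mod_cast (natCast_zsmul r (2 ^ M)).trans h

/-- Multiples by congruent integers agree on an element killed by the modulus. [folklore] -/
theorem zsmul_eq_zsmul_of_dvd_sub {r : R} {m a c : ℤ} (hm : m • r = 0) (h : m ∣ a - c) : a • r = c • r := by
  obtain ⟨k, hk⟩ := h
  have hac : a = c + m * k := by rw [← hk]; ring
  rw [hac, add_zsmul, mul_comm, mul_zsmul, hm, zsmul_zero, add_zero]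

/-- **The order bookkeeping of the invariant lost-bit law.** `g` of order `2^M`, `r` of order `2^{N_y}` with `N_y ≤ M`,
`a • g` of order `2^{N_x}`: then `a • (2 • r)` has order `2^(N_x + N_y − (M + 1))` (natural-number subtraction; the value is
`0` exactly when `N_x + N_y ≤ M + 1`). [folklore] -/
theorem addOrderOf_zsmul_two_nsmul_eq {M : ℕ} {g : G} (hg : addOrderOf g = 2 ^ M) {r : R} {Ny : ℕ}
    (hr : addOrderOf r = 2 ^ Ny) (hNyM : Ny ≤ M) (a : ℤ) {Nx : ℕ} (hNx : addOrderOf (a • g) = 2 ^ Nx) :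
    addOrderOf (a • (2 • r)) = 2 ^ (Nx + Ny - (M + 1)) := by
  have hMr : (2 ^ M : ℤ) • r = 0 := two_pow_zsmul_eq_zero_of_addOrderOf_eq hr hNyM
  have hM2r : ((2 ^ M : ℕ) : ℤ) • (2 • r) = 0 := by
    rw [smul_comm, show ((2 ^ M : ℕ) : ℤ) = (2 ^ M : ℤ) by norm_cast, hMr, smul_zero]
  rcases zsmul_eq_zero_or_eq_two_pow_mul_odd_nsmul hg a with h0 | ⟨v, s, hv, hs, ha⟩
  · -- `a • g = 0`: then `2^M ∣ a`, `N_x = 0`, and `a • (2 • r) = 0`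
    rw [h0, addOrderOf_zero] at hNx
    have hNx0 : Nx = 0 := (eq_of_two_pow_eq_two_pow ((pow_zero 2).trans hNx)).symm
    have hdvd : ((addOrderOf g : ℕ) : ℤ) ∣ a - 0 := by
      rw [sub_zero]; exact (addOrderOf_dvd_iff_zsmul_eq_zero).mpr h0
    rw [hg] at hdvd
    have hzero : a • (2 • r) = 0 := by rw [zsmul_eq_zsmul_of_dvd_sub hM2r hdvd, zero_zsmul]
    rw [hzero, addOrderOf_zero, hNx0]
    have : 0 + Ny - (M + 1) = 0 := by omega
    rw [this, pow_zero]
  · -- `a • g = (2^v s) • g`, `v < M`, `s` odd: `N_x = M − v` and `a • (2 • r) = (2^(v+1) s) • r`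
    rw [ha, addOrderOf_two_pow_mul_odd_nsmul hg hv.le hs] at hNx
    have hNx' : Nx = M - v := (eq_of_two_pow_eq_two_pow hNx).symm
    have hdvd : ((addOrderOf g : ℕ) : ℤ) ∣ a - ((2 ^ v * s : ℕ) : ℤ) := by
      refine (addOrderOf_dvd_iff_zsmul_eq_zero).mpr ?_
      rw [sub_eq_add_neg, add_zsmul, neg_zsmul, natCast_zsmul, ← ha, add_neg_cancel]
    rw [hg] at hdvd
    have hval : a • (2 • r) = (2 ^ (v + 1) * s) • r := by
      rw [zsmul_eq_zsmul_of_dvd_sub hM2r hdvd, natCast_zsmul, smul_smul]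
      congr 1
      ring
    rw [hval]
    by_cases hle : v + 1 ≤ Ny
    · rw [addOrderOf_two_pow_mul_odd_nsmul hr hle hs]
      congr 1
      omega
    · push Not at hle
      rw [(two_pow_mul_odd_nsmul_eq_zero_iff hr (v + 1) s hs).mpr hle.le, addOrderOf_zero]
      have : Nx + Ny - (M + 1) = 0 := by omega
      rw [this, pow_zero]

end Orders

/-! ## §2 The invariant lost-bit law -/

section Law

variable {A B R : Type*} [AddCommGroup A] [AddCommGroup B] [AddCommGroup R]
  (τ : A →+ A) (hτ : ∀ x, τ (τ x) = x) (σ : B →+ B) (hσ : ∀ y, σ (σ y) = y)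
  (P : A →+ B →+ R) (hinv : ∀ x y, P (τ x) (σ y) = P x y)
  {M : ℕ} (a₀ : A)
  (hspan : ∀ Q : A, ∃ a b : ℤ, Q = a • a₀ + b • τ a₀)
  (hfree : ∀ a b : ℤ, a • a₀ + b • τ a₀ = 0 → (2 ^ M : ℤ) ∣ a ∧ (2 ^ M : ℤ) ∣ b)
  (htor : (2 ^ M : ℤ) • a₀ = 0)
  (hnd : ∀ y : B, P a₀ y = 0 → P (τ a₀) y = 0 → y = 0)

include hσ hinv in
/-- Moving the involution across an INVARIANT pairing: `P(τa, b) = P(a, σb)`. [folklore] -/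
theorem pairing_tau_left_of_invariant (x : A) (y : B) : P (τ x) y = P x (σ y) := by
  have h := hinv x (σ y)
  rwa [hσ] at h

include hσ hinv in
/-- For a `σ`-fixed `b`: `P(τa, b) = P(a, b)`. [folklore] -/
theorem pairing_tau_left_of_fixed {y : B} (hy : σ y = y) (x : A) : P (τ x) y = P x y := by
  rw [pairing_tau_left_of_invariant τ σ hσ P hinv, hy]

include hσ hinv in
/-- For a `σ`-anti-fixed `b`: `P(τa, b) = −P(a, b)`. [folklore] -/
theorem pairing_tau_left_of_antifixed {y : B} (hy : σ y = -y) (x : A) : P (τ x) y = -P x y := by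
  rw [pairing_tau_left_of_invariant τ σ hσ P hinv, hy, map_neg]

include htor in
/-- `P(a₀, b)` is killed by `2^M`. [folklore] -/
theorem two_pow_zsmul_pairing_basis_eq_zero (y : B) : (2 ^ M : ℤ) • P a₀ y = 0 := by
  rw [← AddMonoidHom.zsmul_apply, ← map_zsmul, htor, map_zero, AddMonoidHom.zero_apply]

include hσ hinv hnd in
/-- **The basis functional detects the order of an eigenvector.** For `σb = ±b`: `addOrderOf (P a₀ b) = addOrderOf b`
(right non-degeneracy against `a₀, τa₀` and `P(τa₀, b) = ±P(a₀, b)`). [folklore] -/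
theorem addOrderOf_pairing_basis_eq_of_eigen {y : B} (hy : σ y = y ∨ σ y = -y) :
    addOrderOf (P a₀ y) = addOrderOf y := by
  apply Nat.dvd_antisymm
  · rw [addOrderOf_dvd_iff_nsmul_eq_zero, ← map_nsmul, addOrderOf_nsmul_eq_zero, map_zero]
  · rw [addOrderOf_dvd_iff_nsmul_eq_zero]
    apply hnd
    · rw [map_nsmul, addOrderOf_nsmul_eq_zero]
    · rw [map_nsmul]
      rcases hy with hy | hy
      · rw [pairing_tau_left_of_fixed τ σ hσ P hinv hy, addOrderOf_nsmul_eq_zero]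
      · rw [pairing_tau_left_of_antifixed τ σ hσ P hinv hy, smul_neg, addOrderOf_nsmul_eq_zero, neg_zero]

include hσ hinv htor hnd in
/-- The exponent of an eigenvector of `B` is at most `M` (`2^M` kills `P(a₀, b)`, which has the order of `b`). [folklore] -/
theorem exponent_le_of_eigen {y : B} (hy : σ y = y ∨ σ y = -y) {Ny : ℕ} (hNy : addOrderOf y = 2 ^ Ny) : Ny ≤ M := by
  have h : addOrderOf (P a₀ y) ∣ 2 ^ M := by
    rw [addOrderOf_dvd_iff_nsmul_eq_zero, ← natCast_zsmul]
    exact_mod_cast two_pow_zsmul_pairing_basis_eq_zero P a₀ htor y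
  rw [addOrderOf_pairing_basis_eq_of_eigen τ σ hσ P hinv a₀ hnd hy, hNy] at h
  exact (Nat.pow_dvd_pow_iff_le_right one_lt_two).mp h

include hτ hσ hinv hspan hfree htor in
/-- **Opposite signs are orthogonal (invariant pairing).** `τa = a`, `σb = −b ⟹ P(a, b) = 0`, and `τa = −a`, `σb = b ⟹
P(a, b) = 0`: in a `τ`-invariant pairing the `+`-part of `A` pairs trivially with the `−`-part of `B` and vice versa — at a
Kolyvagin place of `K` this is «classes of opposite `τ`-sign are orthogonal under the local Tate pairing», the `p = 2`
shadow of Howard's Lemma 1.5.3 / McCallum's Lemma 5.3. [cite: McCallumLMS1991, §5 Lemma 5.3]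
[cite: Howard2004HeegnerKolyvagin, Lemma 1.5.3] -/
theorem pairing_eq_zero_of_opposite_signs :
    (∀ (x : A) (y : B), τ x = x → σ y = -y → P x y = 0) ∧ (∀ (x : A) (y : B), τ x = -x → σ y = y → P x y = 0) := by
  constructor
  · intro x y hx hy
    obtain ⟨a, rfl⟩ := exists_eq_zsmul_norm_of_tau_eq τ hτ a₀ hspan hfree htor hx
    rw [map_zsmul, AddMonoidHom.zsmul_apply, map_add, AddMonoidHom.add_apply,
      pairing_tau_left_of_antifixed τ σ hσ P hinv hy, add_neg_cancel, zsmul_zero]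
  · intro x y hx hy
    obtain ⟨a, rfl⟩ := exists_eq_zsmul_conorm_of_tau_eq_neg τ hτ a₀ hspan hfree htor hx
    rw [map_zsmul, AddMonoidHom.zsmul_apply, map_sub, AddMonoidHom.sub_apply,
      pairing_tau_left_of_fixed τ σ hσ P hinv hy, sub_self, zsmul_zero]

include hτ hσ hinv hspan hfree htor hnd in
/-- **THE INVARIANT LOST-BIT LAW (same sign).** `P : A × B → R` bi-additive with `P(τa, σb) = P(a, b)`, `A` free of rank one
over `ℤ/2^M[τ]` on `a₀`, `P` right-non-degenerate against `a₀, τa₀`.  For `τa = a`, `σb = b` (or `τa = −a`, `σb = −b`) with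
`addOrderOf a = 2^{N_a}`, `addOrderOf b = 2^{N_b}`:  **`addOrderOf (P a b) = 2^(N_a + N_b − (M + 1))`** — exactly one bit is
lost (`a = α(a₀ ± τa₀)`, `P(a, b) = α · 2 · P(a₀, b)`).  At a deep inert Kolyvagin place of the Heegner field at `p = 2` this is
the order of the local Tate pairing of two same-sign Kolyvagin classes, one read modulo the Kummer condition, the other
unramified. [cite: Kolyvagin1991MathAnn, Thm. 2.1] [cite: McCallumLMS1991, §4 Prop. 4.4, §5 Lemma 5.3 and (13)] -/
theorem invariantLostBit_addOrderOf_pairing_same_sign {x : A} {y : B}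
    (hxy : (τ x = x ∧ σ y = y) ∨ (τ x = -x ∧ σ y = -y))
    {Nx Ny : ℕ} (hNx : addOrderOf x = 2 ^ Nx) (hNy : addOrderOf y = 2 ^ Ny) :
    addOrderOf (P x y) = 2 ^ (Nx + Ny - (M + 1)) := by
  have hyeig : σ y = y ∨ σ y = -y := hxy.elim (fun h ↦ Or.inl h.2) (fun h ↦ Or.inr h.2)
  have hr : addOrderOf (P a₀ y) = 2 ^ Ny := by
    rw [addOrderOf_pairing_basis_eq_of_eigen τ σ hσ P hinv a₀ hnd hyeig, hNy]
  have hNyM : Ny ≤ M := exponent_le_of_eigen τ σ hσ P hinv a₀ htor hnd hyeig hNy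
  rcases hxy with ⟨hx, hy⟩ | ⟨hx, hy⟩
  · -- fixed × fixed: `x = a • (a₀ + τa₀)`, `P x y = a • (2 • P a₀ y)`
    obtain ⟨a, rfl⟩ := exists_eq_zsmul_norm_of_tau_eq τ hτ a₀ hspan hfree htor hx
    have hval : P (a • (a₀ + τ a₀)) y = a • (2 • P a₀ y) := by
      rw [map_zsmul, AddMonoidHom.zsmul_apply, map_add, AddMonoidHom.add_apply,
        pairing_tau_left_of_fixed τ σ hσ P hinv hy, two_nsmul]
    rw [hval]
    exact addOrderOf_zsmul_two_nsmul_eq (addOrderOf_norm_eq τ a₀ hfree htor) hr hNyM a hNx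
  · -- anti × anti: `x = a • (a₀ − τa₀)`, `P x y = a • (2 • P a₀ y)`
    obtain ⟨a, rfl⟩ := exists_eq_zsmul_conorm_of_tau_eq_neg τ hτ a₀ hspan hfree htor hx
    have hval : P (a • (a₀ - τ a₀)) y = a • (2 • P a₀ y) := by
      rw [map_zsmul, AddMonoidHom.zsmul_apply, map_sub, AddMonoidHom.sub_apply,
        pairing_tau_left_of_antifixed τ σ hσ P hinv hy, sub_neg_eq_add, two_nsmul]
    rw [hval]
    exact addOrderOf_zsmul_two_nsmul_eq (addOrderOf_conorm_eq τ a₀ hfree htor) hr hNyM a hNx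

include hτ hσ hinv hspan hfree htor hnd in
/-- **Vanishing threshold of the invariant lost-bit law.** Under the hypotheses of
`invariantLostBit_addOrderOf_pairing_same_sign`: `2^j • P a b = 0 ⟺ N_a + N_b ≤ M + 1 + j`.  With `j = 0`: the local term of two
same-sign classes VANISHES iff `N_a + N_b ≤ M + 1` — the informativeness guard `d′ + d″ + 2 ≤ M` of Kolyvagin's two-term identity
(`N = M − d`). [cite: Kolyvagin1991MathAnn, Thm. 2.1] [cite: McCallumLMS1991, §5 (13)] -/
theorem pow_smul_pairing_eq_zero_iff_of_same_sign {x : A} {y : B}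
    (hxy : (τ x = x ∧ σ y = y) ∨ (τ x = -x ∧ σ y = -y))
    {Nx Ny : ℕ} (hNx : addOrderOf x = 2 ^ Nx) (hNy : addOrderOf y = 2 ^ Ny) (j : ℕ) :
    (2 ^ j) • P x y = 0 ↔ Nx + Ny ≤ M + 1 + j := by
  rw [← addOrderOf_dvd_iff_nsmul_eq_zero,
    invariantLostBit_addOrderOf_pairing_same_sign τ hτ σ hσ P hinv a₀ hspan hfree htor hnd hxy hNx hNy,
    Nat.pow_dvd_pow_iff_le_right one_lt_two]
  omega

include hτ hσ hinv hspan hfree htor hnd in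
/-- **Non-vanishing form** (the shape used at the NEW prime `λ′` of the swap): if `N_a + N_b ≥ M + 2` then `P a b ≠ 0`.
[cite: Kolyvagin1991MathAnn, Thm. 2.1] -/
theorem pairing_ne_zero_of_same_sign {x : A} {y : B}
    (hxy : (τ x = x ∧ σ y = y) ∨ (τ x = -x ∧ σ y = -y))
    {Nx Ny : ℕ} (hNx : addOrderOf x = 2 ^ Nx) (hNy : addOrderOf y = 2 ^ Ny) (h : M + 2 ≤ Nx + Ny) :
    P x y ≠ 0 := by
  intro h0
  have h1 : (2 ^ 0) • P x y = 0 := by rw [h0, smul_zero]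
  have := (pow_smul_pairing_eq_zero_iff_of_same_sign τ hτ σ hσ P hinv a₀ hspan hfree htor hnd hxy hNx hNy 0).mp h1
  omega

end Law

/-! ## §3 The law with the basis value's order displayed (no non-degeneracy hypothesis; either orientation) -/

section Displayed

variable {A B R : Type*} [AddCommGroup A] [AddCommGroup B] [AddCommGroup R]
  (τ : A →+ A) (hτ : ∀ x, τ (τ x) = x) (σ : B →+ B) (hσ : ∀ y, σ (σ y) = y)
  (P : A →+ B →+ R) (hinv : ∀ x y, P (τ x) (σ y) = P x y)
  {M : ℕ} (a₀ : A)
  (hspan : ∀ Q : A, ∃ a b : ℤ, Q = a • a₀ + b • τ a₀)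
  (hfree : ∀ a b : ℤ, a • a₀ + b • τ a₀ = 0 → (2 ^ M : ℤ) ∣ a ∧ (2 ^ M : ℤ) ∣ b)
  (htor : (2 ^ M : ℤ) • a₀ = 0)

include htor in
/-- The exponent of the basis value `P(a₀, b)` is at most `M`. [folklore] -/
theorem exponent_pairing_basis_le {y : B} {Ny : ℕ} (hPy : addOrderOf (P a₀ y) = 2 ^ Ny) : Ny ≤ M := by
  have h : addOrderOf (P a₀ y) ∣ 2 ^ M := by
    rw [addOrderOf_dvd_iff_nsmul_eq_zero, ← natCast_zsmul]
    exact_mod_cast two_pow_zsmul_pairing_basis_eq_zero P a₀ htor y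
  rw [hPy] at h
  exact (Nat.pow_dvd_pow_iff_le_right one_lt_two).mp h

include hτ hσ hinv hspan hfree htor in
/-- **THE INVARIANT LOST-BIT LAW, the order of the basis value displayed.** Same as
`invariantLostBit_addOrderOf_pairing_same_sign` but with the hypothesis `addOrderOf (P a₀ b) = 2^{N_b}` in place of
`addOrderOf b = 2^{N_b}` + right non-degeneracy — the shape needed when `b` is read MODULO an isotropic subgroup of `B` (at the OLD
prime `λ₀` of Kolyvagin's swap the own class `c_M(nℓ₀)` sits on the right and only its order modulo the Kummer condition
`𝓛_{λ₀}` is known, from Q2): for `τa = εa`, `σb = εb`, `addOrderOf a = 2^{N_a}`: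
**`addOrderOf (P a b) = 2^(N_a + N_b − (M + 1))`**. [cite: Kolyvagin1991MathAnn, Thm. 2.1]
[cite: McCallumLMS1991, §4 Prop. 4.4, §5 (13)] -/
theorem invariantLostBit_addOrderOf_pairing_same_sign_of_basis {x : A} {y : B}
    (hxy : (τ x = x ∧ σ y = y) ∨ (τ x = -x ∧ σ y = -y))
    {Nx Ny : ℕ} (hNx : addOrderOf x = 2 ^ Nx) (hPy : addOrderOf (P a₀ y) = 2 ^ Ny) :
    addOrderOf (P x y) = 2 ^ (Nx + Ny - (M + 1)) := by
  have hNyM : Ny ≤ M := exponent_pairing_basis_le P a₀ htor hPy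
  rcases hxy with ⟨hx, hy⟩ | ⟨hx, hy⟩
  · obtain ⟨a, rfl⟩ := exists_eq_zsmul_norm_of_tau_eq τ hτ a₀ hspan hfree htor hx
    have hval : P (a • (a₀ + τ a₀)) y = a • (2 • P a₀ y) := by
      rw [map_zsmul, AddMonoidHom.zsmul_apply, map_add, AddMonoidHom.add_apply,
        pairing_tau_left_of_fixed τ σ hσ P hinv hy, two_nsmul]
    rw [hval]
    exact addOrderOf_zsmul_two_nsmul_eq (addOrderOf_norm_eq τ a₀ hfree htor) hPy hNyM a hNx
  · obtain ⟨a, rfl⟩ := exists_eq_zsmul_conorm_of_tau_eq_neg τ hτ a₀ hspan hfree htor hx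
    have hval : P (a • (a₀ - τ a₀)) y = a • (2 • P a₀ y) := by
      rw [map_zsmul, AddMonoidHom.zsmul_apply, map_sub, AddMonoidHom.sub_apply,
        pairing_tau_left_of_antifixed τ σ hσ P hinv hy, sub_neg_eq_add, two_nsmul]
    rw [hval]
    exact addOrderOf_zsmul_two_nsmul_eq (addOrderOf_conorm_eq τ a₀ hfree htor) hPy hNyM a hNx

include hτ hσ hinv hspan hfree htor in
/-- **Threshold form, basis value displayed**: `2^j • P a b = 0 ⟺ N_a + N_b ≤ M + 1 + j`.
[cite: Kolyvagin1991MathAnn, Thm. 2.1] -/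
theorem pow_smul_pairing_eq_zero_iff_of_same_sign_of_basis {x : A} {y : B}
    (hxy : (τ x = x ∧ σ y = y) ∨ (τ x = -x ∧ σ y = -y))
    {Nx Ny : ℕ} (hNx : addOrderOf x = 2 ^ Nx) (hPy : addOrderOf (P a₀ y) = 2 ^ Ny) (j : ℕ) :
    (2 ^ j) • P x y = 0 ↔ Nx + Ny ≤ M + 1 + j := by
  rw [← addOrderOf_dvd_iff_nsmul_eq_zero,
    invariantLostBit_addOrderOf_pairing_same_sign_of_basis τ hτ σ hσ P hinv a₀ hspan hfree htor hxy hNx hPy,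
    Nat.pow_dvd_pow_iff_le_right one_lt_two]
  omega

/-- **Reading the basis value's order off an ISOTROPIC subgroup.** If `P(a₀, ·)` and `P(τa₀, ·)` kill a subgroup `L ≤ B` and
`y − y′ ∈ L`, then `P(a₀, y) = P(a₀, y′)`: the basis value only sees `y` modulo `L` (at `λ₀`: modulo the Kummer condition).
[folklore] -/
theorem pairing_basis_eq_of_sub_mem {L : AddSubgroup B} (hL : ∀ z ∈ L, P a₀ z = 0) {y y' : B} (h : y - y' ∈ L) :
    P a₀ y = P a₀ y' := by
  have := hL _ h
  rwa [map_sub, sub_eq_zero] at this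

end Displayed

end Summit.BirchSwinnertonDyer.BirchSwinnertonDyer.Theorems.GenusExact.PlusDescent
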